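import Summits.FinalStateConjecture.FinalStateConjecture.Theorems.EIHFluxBalanceInertialRecessionRechartAdaptedProfile
import Mathlib.Analysis.SpecialFunctions.Sqrt

/-!
# Route EIHFluxBalance — `InertialRecession`, re-charting: the adapted meshing profile, SQUARE-ROOT
# TILT form (clock slack of the proper-time clock versus the rest-slab tilt `√(ũ⁰² − 1)`)

Helper file for the crux `stmt-FinalStateConjecture-10166`
(`Summit.FinalStateConjecture.FinalStateConjecture.Theses.EIHFluxBalance.InertialRecession`),
stub `stub_rechart` (the transfer P2 of line `sublinear-is-free-clean-window-charges`).

For the clock charts the natural smooth modulus is `w(t) = ũ⁰(t) − 1` (`w' = (ũ⁰)' → 0` by slaving),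
the slack rate is `s' = 1 − 1/ũ⁰ = w/(1 + w) ≥ w/γ`, and the tilt coefficient is
`√(ũ⁰² − 1) = √(w(w + 2)) ≤ √(γ + 1) √w` — NOT a smooth function of `t` where `w = 0`. So the
coupling of …RechartAdaptedProfile is needed in the form `s' ≥ c w`, `w' → 0`, tilt `√w · Rb`:
`exists_adapted_profile_sqrt` — for every monotone cap `→ ∞` there is a monotone `Rb ≤ cap`,
`Rb → ∞`, with `√(w t) · Rb t ≤ s t` for late `t` (key inequality `sq_le_of_slack`: `|w'| ≤ η` on
`[t − w(t)/(2η), t]` gives `c w(t)² ≤ 4η s(t)`; with `η = c s₀³/(4(n+1)⁴)`, `√w · (n+1) ≤ s`).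
[folklore real analysis]
-/

noncomputable section

set_option linter.dupNamespace false

open Set Filter Topology

namespace Summit.FinalStateConjecture.FinalStateConjecture.Theorems

/-- **Slack beats modulus, linear form.** `s' ≥ c w` (`c > 0`), `s ≥ 0`, `w(t) ≥ 0`, `|w'| ≤ η` on
`[t − w(t)/(2η), t]` (`η > 0`) give `c w(t)² ≤ 4 η s(t)`. [folklore] -/
theorem sq_le_of_slack {s w : ℝ → ℝ} {c η t : ℝ} (hc : 0 < c) (hη : 0 < η)
    (hsd : Differentiable ℝ s) (hwd : Differentiable ℝ w) (hs0 : ∀ τ, 0 ≤ s τ) (hw0 : 0 ≤ w t)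
    (hslack : ∀ τ, c * w τ ≤ deriv s τ)
    (hw' : ∀ τ ∈ Icc (t - w t / (2 * η)) t, |deriv w τ| ≤ η) :
    c * w t ^ 2 ≤ 4 * η * s t := by
  rcases hw0.eq_or_lt with h0 | hpos
  · rw [← h0]; have := hs0 t; nlinarith
  set L : ℝ := w t / (2 * η) with hL
  have hL0 : 0 < L := by rw [hL]; positivity
  have hwlow : ∀ τ ∈ Icc (t - L) t, w t / 2 ≤ w τ := by
    intro τ hτ
    have hmv := (convex_Icc (t - L) t).image_sub_le_mul_sub_of_deriv_le
      (hwd.continuous.continuousOn) (hwd.differentiableOn.mono interior_subset)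
      (fun x hx ↦ (le_abs_self _).trans (hw' x (interior_subset hx))) τ hτ t
      ⟨by linarith [hτ.2], le_rfl⟩ hτ.2
    have h1 : η * (t - τ) ≤ η * L := mul_le_mul_of_nonneg_left (by linarith [hτ.1]) hη.le
    have h2 : η * L = w t / 2 := by rw [hL]; field_simp
    linarith
  have hgain : c * (w t / 2) * (t - (t - L)) ≤ s t - s (t - L) :=
    (convex_Icc (t - L) t).mul_sub_le_image_sub_of_le_deriv hsd.continuous.continuousOn
      (hsd.differentiableOn.mono interior_subset)
      (fun x hx ↦ (mul_le_mul_of_nonneg_left (hwlow x (interior_subset hx)) hc.le).trans (hslack x))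
      (t - L) ⟨le_rfl, by linarith⟩ t ⟨by linarith, le_rfl⟩ (by linarith)
  rw [sub_sub_cancel] at hgain
  have hsL := hs0 (t - L)
  have hkey : c * (w t / 2) * L = c * w t ^ 2 / (4 * η) := by rw [hL]; field_simp; ring
  rw [hkey, div_le_iff₀ (by positivity)] at hgain
  nlinarith

/-- From `c w² ≤ 4η s`, `η = c s₀³/(4 n⁴)`, `0 < s₀ ≤ s`: `√w · n ≤ s`. [folklore] -/
theorem sqrt_mul_le_of_sq_le {c s₀ s w n : ℝ} (hc : 0 < c) (hs₀ : 0 < s₀) (hs : s₀ ≤ s) (hn : 0 < n)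
    (h : c * w ^ 2 ≤ 4 * (c * s₀ ^ 3 / (4 * n ^ 4)) * s) : Real.sqrt w * n ≤ s := by
  have hs0 : 0 ≤ s := hs₀.le.trans hs
  have h1 : w ^ 2 ≤ s₀ ^ 3 * s / n ^ 4 := by
    have : 4 * (c * s₀ ^ 3 / (4 * n ^ 4)) * s = c * (s₀ ^ 3 * s / n ^ 4) := by field_simp
    rw [this] at h
    exact le_of_mul_le_mul_left h hc
  have h2 : s₀ ^ 3 * s / n ^ 4 ≤ ((s / n) ^ 2) ^ 2 := by
    rw [← pow_mul, div_pow]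
    refine div_le_div_of_nonneg_right ?_ (by positivity)
    have h4 : s₀ ^ 3 ≤ s ^ 3 := pow_le_pow_left₀ hs₀.le hs 3
    calc s₀ ^ 3 * s ≤ s ^ 3 * s := mul_le_mul_of_nonneg_right h4 hs0
      _ = s ^ (2 * 2) := by ring
  have h3 : w ≤ (s / n) ^ 2 := le_of_pow_le_pow_left₀ two_ne_zero (sq_nonneg _) (h1.trans h2)
  have h4 : Real.sqrt w ≤ s / n := by
    rw [← Real.sqrt_sq (div_nonneg hs0 hn.le)]
    exact Real.sqrt_le_sqrt h3
  rwa [le_div_iff₀ hn] at h4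

/-- **The adapted meshing profile, square-root tilt.** `s' ≥ c β` (`c > 0`), `s ≥ s₀ > 0`,
`0 ≤ β ≤ B`, `β' → 0`: for every monotone cap `→ ∞` a monotone profile `Rb ≤ cap`, `Rb → ∞`, with
`√(β t) Rb t ≤ s t` for late `t`. [folklore] -/
theorem exists_adapted_profile_sqrt {s β : ℝ → ℝ} {c s₀ B : ℝ} (hc : 0 < c) (hs₀ : 0 < s₀) (hB : 0 ≤ B)
    (hsd : Differentiable ℝ s) (hβd : Differentiable ℝ β) (hs : ∀ t, s₀ ≤ s t)
    (hβ0 : ∀ t, 0 ≤ β t) (hβB : ∀ t, β t ≤ B) (hslack : ∀ t, c * β t ≤ deriv s t)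
    (hβ' : Tendsto (deriv β) atTop (𝓝 0)) (cap : ℝ → ℝ) (hcap : Monotone cap)
    (hcaptop : Tendsto cap atTop atTop) :
    ∃ Rb : ℝ → ℝ, Monotone Rb ∧ Tendsto Rb atTop atTop ∧ (∀ t, Rb t ≤ cap t) ∧
      ∃ T : ℝ, ∀ t, T ≤ t → Real.sqrt (β t) * Rb t ≤ s t := by
  classical
  have hs0 : ∀ t, 0 ≤ s t := fun t ↦ hs₀.le.trans (hs t)
  -- stage `n`: derivative threshold `η n` and a time `T n` after which `|β'| ≤ η n`
  set η : ℕ → ℝ := fun n ↦ c * s₀ ^ 3 / (4 * ((n : ℝ) + 1) ^ 4) with hη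
  have hη0 : ∀ n, 0 < η n := fun n ↦ by rw [hη]; positivity
  have hT : ∀ n : ℕ, ∃ T : ℝ, ∀ τ, T ≤ τ → |deriv β τ| ≤ η n := fun n ↦ by
    obtain ⟨T, hT⟩ := (Metric.tendsto_atTop.mp hβ') (η n) (hη0 n)
    exact ⟨T, fun τ hτ ↦ by have := hT τ hτ; rw [dist_zero_right, Real.norm_eq_abs] at this; exact this.le⟩
  choose T hT using hT
  -- monotone stage start times `S n`, with room for the window `B/(2 η n)`
  set S : ℕ → ℝ := fun n ↦ (Finset.range (n + 1)).sup' ⟨0, by simp⟩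
    (fun k ↦ |T k| + B / (2 * η k) + k) with hSdef
  have hSge : ∀ n k, k ≤ n → |T k| + B / (2 * η k) + k ≤ S n := fun n k hk ↦
    Finset.le_sup' (fun k ↦ |T k| + B / (2 * η k) + (k : ℝ)) (Finset.mem_range.mpr (Nat.lt_succ_of_le hk))
  have hSmono : Monotone S := fun m n hmn ↦
    Finset.sup'_le _ _ fun k hk ↦ hSge n k ((Nat.lt_succ_iff.mp (Finset.mem_range.mp hk)).trans hmn)
  have hSn : ∀ n : ℕ, (n : ℝ) ≤ S n := fun n ↦ by
    have h := hSge n n le_rfl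
    have : 0 ≤ B / (2 * η n) := by positivity
    linarith [abs_nonneg (T n)]
  -- the stage index of a time: the number of stages already started
  set idx : ℝ → ℕ := fun t ↦ Nat.find (p := fun n ↦ t < S (n + 1)) (by
    obtain ⟨n, hn⟩ := exists_nat_gt t
    exact ⟨n, hn.trans_le ((hSn (n + 1)).trans' (by push_cast; linarith))⟩) with hidx
  have hidx_spec : ∀ t, t < S (idx t + 1) := fun t ↦ Nat.find_spec (p := fun n ↦ t < S (n + 1)) _
  have hidx_min : ∀ t n, n < idx t → S (n + 1) ≤ t := fun t n hn ↦
    not_lt.mp (Nat.find_min (p := fun n ↦ t < S (n + 1)) _ hn)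
  have hidx_mono : ∀ t t', t ≤ t' → idx t ≤ idx t' := by
    intro t t' htt'
    by_contra h
    push Not at h
    have h1 := hidx_min t (idx t') h
    have h2 := hidx_spec t'
    linarith
  have hidx_ge : ∀ t n, S n ≤ t → n ≤ idx t := by
    intro t n hn
    by_contra h
    push Not at h
    have h1 := hidx_spec t
    have h2 : S (idx t + 1) ≤ S n := hSmono h
    linarith
  -- the profile
  refine ⟨fun t ↦ min (idx t : ℝ) (cap t), fun t t' htt' ↦ ?_, ?_, fun t ↦ min_le_right _ _, ⟨S 0, fun t ht ↦ ?_⟩⟩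
  · exact min_le_min (by exact_mod_cast hidx_mono t t' htt') (hcap htt')
  · refine tendsto_atTop_atTop.mpr fun b ↦ ?_
    obtain ⟨n, hn⟩ := exists_nat_ge b
    obtain ⟨tc, htc⟩ := eventually_atTop.1 (tendsto_atTop.1 hcaptop b)
    refine ⟨max (S n) tc, fun t ht ↦ le_min ?_ (htc t ((le_max_right _ _).trans ht))⟩
    exact hn.trans (by exact_mod_cast hidx_ge t n ((le_max_left _ _).trans ht))
  · -- at stage `n = idx t`: `|β'| ≤ η n` on the window, so `√β · (n+1) ≤ s`, and `Rb t ≤ n`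
    set n : ℕ := idx t with hn
    have hsq0 : 0 ≤ Real.sqrt (β t) := Real.sqrt_nonneg _
    have hβRb : Real.sqrt (β t) * min (n : ℝ) (cap t) ≤ Real.sqrt (β t) * n :=
      mul_le_mul_of_nonneg_left (min_le_left _ _) hsq0
    refine hβRb.trans ?_
    rcases Nat.eq_zero_or_pos n with hn0 | hnpos
    · rw [hn0, Nat.cast_zero, mul_zero]; exact hs0 t
    have hSt : S n ≤ t := by
      have := hidx_min t (n - 1) (by omega)
      rwa [Nat.sub_add_cancel hnpos] at this
    have hwin : ∀ τ ∈ Icc (t - β t / (2 * η n)) t, |deriv β τ| ≤ η n := by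
      intro τ hτ
      apply hT n
      have h1 := hSge n n le_rfl
      have h2 : β t / (2 * η n) ≤ B / (2 * η n) :=
        div_le_div_of_nonneg_right (hβB t) (by positivity)
      linarith [hτ.1, (Nat.cast_nonneg n : (0 : ℝ) ≤ n), le_abs_self (T n)]
    have hsqle := sq_le_of_slack hc (hη0 n) hsd hβd hs0 (hβ0 t) hslack hwin
    have hnR : (0 : ℝ) < (n : ℝ) + 1 := by positivity
    have h1 : Real.sqrt (β t) * ((n : ℝ) + 1) ≤ s t :=
      sqrt_mul_le_of_sq_le hc hs₀ (hs t) hnR (by rw [hη] at hsqle; exact hsqle)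
    nlinarith [hsq0]

/-- Registered one-line form (stub `sqrt_mul_le_of_sq_le_rechart` of the crux item) of
`sqrt_mul_le_of_sq_le`. [folklore] -/
theorem sqrt_mul_le_of_sq_le_rechart : ∀ {c s₀ s w n : ℝ}, 0 < c → 0 < s₀ → s₀ ≤ s → 0 < n → c * w ^ 2 ≤ 4 * (c * s₀ ^ 3 / (4 * n ^ 4)) * s → Real.sqrt w * n ≤ s :=
  fun hc hs₀ hs hn h ↦ sqrt_mul_le_of_sq_le hc hs₀ hs hn h

end Summit.FinalStateConjecture.FinalStateConjecture.Theorems
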